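import Summits.MatrixMultiplication.OmegaCensus.SmallFormats.MatMulM22ManyRankOne
import Mathlib.LinearAlgebra.Projection
import Mathlib.LinearAlgebra.Basis.VectorSpace
import HarnessLib

/-!
# ω-census family (a): Alekseev's Lemma 12 mechanism at general frame parameters, part 2 — the dimension count: `≥ 2(m − 2e − g)` rank-one X-forms (any field)

Cell `pub-omega` (unit `pub-omega-tensor`, gen 38), topic `Summits/MatrixMultiplication/OmegaCensus` (sub-folder
`SmallFormats`). Framing (verbatim): lottery ticket; floor = certified bounds/negative ranges. HONEST FRAMING: structural theorem about
bilinear algorithms for `⟨m,2,2⟩` over an ARBITRARY field (NEW in this generality; the mechanism is Alekseev 2015, Lemma 12); NOT a bound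
on any rank by itself; nothing here is a bound on `ω`.

Part 1 (`MatMulM22ManyRankOne`) showed: for a frame `F`, a subfamily `I' ⊆ I` with independent `f_p`, and any subspace `C ⊆ k^m` of
vectors `c` with `κc` vanishing on `I ∖ I'`, `R_c := ∑_{p∈I} κc_p D_p^2 = ∑ r_j P_j` and `hh(r)` vanishing on `I ∖ I'`, at least `2·dim C`
members of `I'` have rank-one X-forms (`q_p ∥ p_p`). Here (`exists_solutionSpace`) such a `C` with
`dim C ≥ 2m − 2|I ∖ I'| − dim span{N_t : t ∈ J} ≥ m − 2e − g` (`|I| = 2m + e`, `|J| = m + g`) is constructed as the kernel of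
`c ↦ (κc|_{I∖I'}, π_E R_c, hh(r(c))|_{I∖I'})` for a complement `E` of `span P` (the `R_i` lie in `span N(J) ⊇ span P` by (7) of the
source, `Frame.R_mem_span_N2`). Consequences:
* `Lemma12Gen.twelve_mul_le` — for EVERY frame: `12m ≤ #{p ∈ I : q_p ∥ p_p} + 4|I| + 2|J|`;
* `Lemma12Gen.fourteen_mul_le_card_rankOne_add` — frame-free: every computation of `⟨m,2,2⟩` of length `d` over any field has at least
  `14m − 4d` indices whose form `g_t` on `y ∈ k^{2×2}` has a rank-one coefficient matrix (`q_t ∥ p_t`; in the census orientation `⟨2,2,m⟩`: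
  rank-one X-forms). At `d = 3m + δ` with a frame of `2m + e` members the count is `≥ 2(m − δ − e)`: e.g. `≥ 2(m − 4)` rank-one X-forms
  among the members of a `(2m+1, m+2)`-frame of a length-`(3m+3)` scheme — the quantitative fact behind tensor g38's LAW-3M3 memo §4.
Desk check (`lemma12probe.py`, the cell's GF(3) schemes): the bound `dim C ≥ m − 2e − g` and `#rank-one ≥ 2 dim C` hold, with equality cases.
-/

namespace Summit.MatrixMultiplication.OmegaCensus.SmallFormats

open Finset Module
open Literature.Computability.AlgebraicComplexity
open Literature.Computability.AlgebraicComplexity.Alekseev2015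

namespace Lemma12Gen

variable {k : Type*} [Field k] {m : ℕ} {ι : Type*} [Fintype ι] [DecidableEq ι]
variable {β : BilinComp (mulBilin k m 2 2) ι} (F : Frame β)

/-- `∑_i c_i R_i = ∑_{p ∈ I} κc_p D_p^2` (swap of sums). -/
private theorem sum_smul_R (c : Fin m → k) :
    ∑ i, c i • (∑ p ∈ F.I, F.κ i p • D2 β p) = ∑ p ∈ F.I, (∑ i, c i * F.κ i p) • D2 β p := by
  simp only [Finset.smul_sum, smul_smul, Finset.sum_smul]
  rw [Finset.sum_comm]

/-- **The solution space.** For every frame `F` and `I' ⊆ I` there is a subspace `C ⊆ k^m`, every member of which satisfies the three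
conditions of the mechanism (with a suitable `r`), of dimension `≥ 2m − 2|I ∖ I'| − dim span{N_t : t ∈ J} ≥ 2m − 2|I ∖ I'| − |J|`. -/
theorem exists_solutionSpace (I' : Finset ι) :
    ∃ C : Submodule k (Fin m → k),
      (∀ c ∈ C, (∀ p ∈ F.I, p ∉ I' → (∑ i, c i * F.κ i p) = 0) ∧
        ∃ r : Fin m → k, ∑ p ∈ F.I, (∑ i, c i * F.κ i p) • D2 β p = ∑ j, r j • rowMap k m j ∧
          ∀ p ∈ F.I, p ∉ I' → (∑ j, r j * F.κ j p) = 0) ∧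
      2 * m ≤ finrank k C + 2 * (F.I \ I').card + F.J.card := by
  classical
  -- the spaces span P ≤ span N(J)
  let SP : Submodule k (Blk k m) := Submodule.span k (Set.range (rowMap k m))
  let K : Submodule k (Blk k m) := Submodule.span k (F.N2 '' (F.J : Set ι))
  have hSPK : SP ≤ K := Submodule.span_le.mpr (by rintro _ ⟨i, rfl⟩; exact F.rowMap_mem_span_N2 i)
  have hSP : finrank k SP = m := by
    show finrank k (Submodule.span k (Set.range (rowMap k m))) = m
    rw [finrank_span_eq_card (linearIndependent_rowMap (k := k) (m := m)), Fintype.card_fin]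
  have hK : finrank k K ≤ F.J.card := by
    have e : K = Submodule.span k (↑(F.J.image F.N2) : Set (Blk k m)) := by
      show Submodule.span k (F.N2 '' (F.J : Set ι)) = _
      rw [Finset.coe_image]
    rw [e]
    exact (finrank_span_finset_le_card (R := k) (F.J.image F.N2)).trans Finset.card_image_le
  -- a complement of span P and the two projections
  obtain ⟨E, hc⟩ := Submodule.exists_isCompl SP
  let πS : Blk k m →ₗ[k] Blk k m := SP.projection E hc
  let πE : Blk k m →ₗ[k] Blk k m := E.projection SP hc.symm
  have hsum : ∀ x, πS x + πE x = x := fun x => Submodule.projection_add_projection_eq_self hc x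
  have hkerE : LinearMap.ker πE = SP := Submodule.ker_projection hc.symm
  -- R_i ∈ K and the coefficients r_i of its SP-component
  let R : Fin m → Blk k m := fun i => ∑ p ∈ F.I, F.κ i p • D2 β p
  have hRK : ∀ i, R i ∈ K := fun i => F.R_mem_span_N2 i
  have hσ : ∀ i, πS (R i) ∈ SP := fun i => Submodule.projection_apply_mem hc (R i)
  choose r hr using fun i => (Submodule.mem_span_range_iff_exists_fun k).1 (hσ i)
  -- the part of K inside E has dimension ≤ dim K − m (SP ⊔ (K ⊓ E) ≤ K, SP ⊓ E = ⊥)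
  have hKE : finrank k ↥(K ⊓ E) + m ≤ finrank k K := by
    have h1 := Submodule.finrank_sup_add_finrank_inf_eq SP (K ⊓ E)
    have h2 : SP ⊓ (K ⊓ E) = ⊥ := by
      rw [eq_bot_iff]
      calc SP ⊓ (K ⊓ E) ≤ SP ⊓ E := inf_le_inf_left _ inf_le_right
        _ = ⊥ := disjoint_iff.1 hc.disjoint
        _ ≤ ⊥ := le_rfl
    have h3 : finrank k ↥(SP ⊔ (K ⊓ E)) ≤ finrank k K := Submodule.finrank_mono (sup_le hSPK inf_le_left)
    rw [h2, finrank_bot, hSP] at h1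
    omega
  have hπEK : ∀ i, πE (R i) ∈ K ⊓ E := by
    intro i
    refine Submodule.mem_inf.2 ⟨?_, Submodule.projection_apply_mem hc.symm (R i)⟩
    have e : πE (R i) = R i - πS (R i) := Submodule.projection_eq_self_sub_projection hc (R i)
    rw [e]
    exact Submodule.sub_mem _ (hRK i) (hSPK (hσ i))
  -- the linear maps
  let L : Finset ι := F.I \ I'
  let Λa : (Fin m → k) →ₗ[k] (↥L → k) :=
    { toFun := fun c l => ∑ i, c i * F.κ i l
      map_add' := fun c c' => by funext l; simp [add_mul, Finset.sum_add_distrib]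
      map_smul' := fun a c => by funext l; simp [Finset.mul_sum, mul_assoc] }
  have hbmem : ∀ c : Fin m → k, ∑ i, c i • πE (R i) ∈ K ⊓ E := fun c =>
    Submodule.sum_mem _ fun i _ => Submodule.smul_mem _ _ (hπEK i)
  let Λb0 : (Fin m → k) →ₗ[k] ↥(K ⊓ E) :=
    { toFun := fun c => ⟨∑ i, c i • πE (R i), hbmem c⟩
      map_add' := fun c c' => by
        apply Subtype.ext
        simp only [Submodule.coe_add, Pi.add_apply, add_smul, Finset.sum_add_distrib]
      map_smul' := fun a c => by
        apply Subtype.ext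
        simp only [Submodule.coe_smul, Pi.smul_apply, smul_eq_mul, mul_smul, Finset.smul_sum, RingHom.id_apply] }
  -- coordinates on K ⊓ E, so that the codomain of Λ below is a product of function spaces
  haveI : Module.Free k ↥(K ⊓ E) := Module.Free.of_divisionRing k ↥(K ⊓ E)
  let bKE := Module.finBasis k ↥(K ⊓ E)
  let Λb : (Fin m → k) →ₗ[k] (Fin (finrank k ↥(K ⊓ E)) → k) := bKE.equivFun.toLinearMap ∘ₗ Λb0
  let Λc : (Fin m → k) →ₗ[k] (↥L → k) :=
    { toFun := fun c l => ∑ j, (∑ i, c i * r i j) * F.κ j l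
      map_add' := fun c c' => by
        funext l; simp only [Pi.add_apply, add_mul, Finset.sum_add_distrib]
      map_smul' := fun a c => by
        funext l; simp only [Pi.smul_apply, smul_eq_mul, RingHom.id_apply, Finset.mul_sum, Finset.sum_mul, mul_assoc] }
  let Λ : (Fin m → k) →ₗ[k] (↥L → k) × ((Fin (finrank k ↥(K ⊓ E)) → k) × (↥L → k)) := Λa.prod (Λb.prod Λc)
  refine ⟨LinearMap.ker Λ, fun c hcker => ?_, ?_⟩
  · -- the three conditions for c ∈ ker Λ
    have h0 := LinearMap.mem_ker.1 hcker
    have ha : Λa c = 0 := congrArg Prod.fst h0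
    have hb : Λb c = 0 := congrArg Prod.fst (congrArg Prod.snd h0)
    have hcc : Λc c = 0 := congrArg Prod.snd (congrArg Prod.snd h0)
    have ha' : ∀ p ∈ F.I, p ∉ I' → (∑ i, c i * F.κ i p) = 0 := by
      intro p hp hpI'
      have hpL : p ∈ L := Finset.mem_sdiff.2 ⟨hp, hpI'⟩
      have := congrFun ha ⟨p, hpL⟩
      simpa [Λa] using this
    have hb' : ∑ i, c i • πE (R i) = 0 := by
      have hb0 : Λb0 c = 0 := by
        have : bKE.equivFun (Λb0 c) = 0 := hb
        exact (LinearEquiv.map_eq_zero_iff _).1 this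
      have := congrArg Subtype.val hb0
      simpa [Λb0] using this
    refine ⟨ha', fun j => ∑ i, c i * r i j, ?_, ?_⟩
    · -- R_c = ∑_i c_i R_i = ∑_i c_i πS(R_i) = ∑_j (∑_i c_i r_ij) P_j
      rw [← sum_smul_R F c]
      have e1 : ∑ i, c i • R i = ∑ i, c i • πS (R i) + ∑ i, c i • πE (R i) := by
        rw [← Finset.sum_add_distrib]
        exact Finset.sum_congr rfl fun i _ => by rw [← smul_add, hsum]
      rw [e1, hb', add_zero]
      have e2 : ∀ i, c i • πS (R i) = ∑ j, (c i * r i j) • rowMap k m j := by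
        intro i
        rw [← hr i, Finset.smul_sum]
        exact Finset.sum_congr rfl fun j _ => by rw [smul_smul]
      rw [Finset.sum_congr rfl fun i _ => e2 i, Finset.sum_comm]
      exact Finset.sum_congr rfl fun j _ => by rw [← Finset.sum_smul]
    · intro p hp hpI'
      have hpL : p ∈ L := Finset.mem_sdiff.2 ⟨hp, hpI'⟩
      have := congrFun hcc ⟨p, hpL⟩
      simpa [Λc] using this
  · -- the dimension count
    have h1 : finrank k (LinearMap.range Λ) + finrank k (LinearMap.ker Λ) = finrank k (Fin m → k) :=
      LinearMap.finrank_range_add_finrank_ker (K := k) Λ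
    have h2 : finrank k (LinearMap.range Λ) ≤ finrank k ((↥L → k) × ((Fin (finrank k ↥(K ⊓ E)) → k) × (↥L → k))) :=
      Submodule.finrank_le (LinearMap.range Λ)
    rw [Module.finrank_prod, Module.finrank_prod, Module.finrank_fintype_fun_eq_card, Module.finrank_fintype_fun_eq_card,
      Fintype.card_coe, Fintype.card_fin] at h2
    have h3 : finrank k (Fin m → k) = m := by rw [Module.finrank_fintype_fun_eq_card, Fintype.card_fin]
    have hLg : L.card = (F.I \ I').card := rfl
    rw [h3] at h1
    omega

open scoped Classical in
/-- **For every frame: `12m ≤ #{p ∈ I : q_p ∥ p_p} + 4|I| + 2|J|`** — at least `12m − 4|I| − 2|J|` frame members have rank-one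
X-forms (with `|I| = 2m + e`, `|J| = m + g`: at least `2(m − 2e − g)`). -/
theorem twelve_mul_le : 12 * m ≤ (F.I.filter fun p => ∃ a : k, qvec β p = a • pvec β p).card + 4 * F.I.card + 2 * F.J.card := by
  classical
  obtain ⟨I', hI'I, hI'card, hI'indep⟩ := F.exists_indep_sub
  obtain ⟨C, hC, hdim⟩ := exists_solutionSpace F I'
  have h1 := two_mul_finrank_le_card_rankOne F hI'I hI'indep C hC
  have h2 : (I'.filter fun p => ∃ a : k, qvec β p = a • pvec β p).card ≤
      (F.I.filter fun p => ∃ a : k, qvec β p = a • pvec β p).card :=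
    Finset.card_le_card (Finset.filter_subset_filter _ hI'I)
  have h3 : (F.I \ I').card = F.I.card - 2 * m := by rw [Finset.card_sdiff_of_subset hI'I, hI'card]
  have h4 : 2 * m ≤ F.I.card := F.two_mul_le_card
  omega

open scoped Classical in
/-- **Frame-free form: a computation of `⟨m,2,2⟩` of length `d` over any field has at least `14m − 4d` indices `t` with `q_t ∥ p_t`**
(rank-one coefficient matrix of the form `g_t` on `y ∈ k^{2×2}`; census orientation `⟨2,2,m⟩`: rank-one X-forms). At `d = 3m + δ`:
`≥ 2(m − 2δ)`; with a frame of `2m + e` members: `≥ 2(m − δ − e)` (use `twelve_mul_le`). -/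
theorem fourteen_mul_le_card_rankOne_add (β : BilinComp (mulBilin k m 2 2) ι) :
    14 * m ≤ (Finset.univ.filter fun t => ∃ a : k, qvec β t = a • pvec β t).card + 4 * Fintype.card ι := by
  classical
  obtain ⟨F⟩ := exists_frame β
  have h1 := twelve_mul_le F
  have h2 : (F.I.filter fun p => ∃ a : k, qvec β p = a • pvec β p).card ≤
      (Finset.univ.filter fun t => ∃ a : k, qvec β t = a • pvec β t).card :=
    Finset.card_le_card (Finset.filter_subset_filter _ (Finset.subset_univ _))
  have h3 := F.le_card_J
  have h4 := F.card_I_add_card_J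
  omega

end Lemma12Gen

end Summit.MatrixMultiplication.OmegaCensus.SmallFormats
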